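import Summits.HubbardSuperconductivity.HubbardSuperconductivity.Theorems.FunctionFieldCertificateMesoscopicPairOrderProfilePosition
import HarnessLib

/-!
# Crux `GoldstonePairProfile` (piece (A) of the BC2 redirect of `MesoscopicPairOrder`, stmt-HubbardSuperconductivity-7331)
# — BIRTH SKELETON (planner cstrat-r1, 2026-08-17)

Piece (A) of the split `MesoscopicPairOrder ⇐ GoldstonePairProfile ∧ LeakBeatingBlockPairSeed` (assembly = the
landed `Theorems.FunctionFieldCertificate.mesoscopicPairOrderOfSubs`, p137259): at EVERY `U > 0`,
`δ ∈ (0, 1/2)` there are `S, A ≥ 0`, `L₀` such that every normalised `(N_L, S^z = 0)`-sector ground state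
`ψ` of `hubbardTorus 2 L 1 U`, `L ≥ L₀` even, has `S_ψ(m) ≤ S + A/|q_m|` for all momentum labels `m ≠ 0`
(`S_ψ = pairStructureFactor dWaveFormFactor L ψ`, `|q_m| = √(momentumNormSq L m)`) — flat normal background
plus a Goldstone `1/|q|`. It implies the route's pole half `WindowInfraredBound` (stmt-1089;
`windowInfraredBound_of_goldstonePairProfile`).

Two REGISTERED STUBS, cut along the MOMENTUM AXIS — exactly the landed position lemma
`goldstonePairProfileIffShapeAndFlat` (p137969/p138196): (A) ⟺ (GS) ∧ (OffWindowFlat).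

* `stub_pairGoldstoneShape` (GS) — the WINDOW Goldstone shape: for all `(U, δ)` there are `A ≥ 0`, `ε₀ > 0`,
  `L₀` with `S_ψ(m)·|q_m| ≤ A` on the punctured window `0 < |q_m| ≤ ε₀`, in every normalised sector ground
  state, eventually in even `L`. VERBATIM the hypothesis of the landed `wib_of_goldstoneShape` (closes stmt-1089
  with `C = 32A`), i.e. the canonical open statement every stmt-1089 engine reduces to: Pitaevskii–Stringari
  moment method with a torus pair-stiffness input (`goldstoneShape_of_momentClosure`, engine B), energy-form
  pair Gaussian domination C⁺_λ + charging floor (`goldstoneShape_of_pairGaussianDomination_of_chargingFloor`,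
  engine C), Landau / pair-yrast floor (`goldstoneShape_of_pairYrastFloor`, engine A) — all pointwise in
  `(U, δ)`, none uses reflection positivity; their inputs are the open physics
  (`Cruxes/WindowInfraredBound/STRATEGY-CENSUS.md`). Shared in content with cruxes stmt-2009 / stmt-1315.
* `stub_offWindowFlat` (Flat) — the flat law OFF every window: for all `(U, δ)` and every `η > 0` there are
  `S(η) ≥ 0`, `L₀` with `S_ψ(m) ≤ S(η)` whenever `|q_m| > η`, in every normalised sector ground state,
  eventually in even `L`: no pair-density-wave Bragg peak `S_ψ(Q) ~ L²` (nor any `L`-divergent pile-up) at a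
  FIXED nonzero momentum in any sector ground state. A priori only the Parseval total `Σ_m S_ψ(m) ≤ 32L²` is
  known (`windowSum_le_apriori`); a single off-window mode is unconstrained. OPEN, independent of (GS) (a PDW at
  `|Q| = π/4` passes (GS) and kills (Flat); a `|q|^{-3/2}` pile-up at `q → 0` passes (Flat) and kills (GS)).

Composition `GoldstonePairProfile_of` = `goldstonePairProfileIffShapeAndFlat.mpr ⟨(GS), (Flat)⟩` (one line:
the cut is an EQUIVALENCE of the piece with the conjunction, so neither stub alone is the piece — (GS) is a
strict consequence of (A), (Flat) is a strict consequence of (A), and only together do they give it back).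

Sources: Kennedy–Lieb–Shastry, PRL 61 (1988) 2582 (infrared-bound shape); Pitaevskii–Stringari, J. Low Temp.
Phys. 85 (1991) 377; Dyson–Lieb–Simon, J. Stat. Phys. 18 (1978) 335 Thm 4.2; Scalapino, Phys. Rep. 250 (1995)
329 §2. No definition enters a registered signature; nothing here claims (GS), (Flat) or (A).
-/

noncomputable section

-- the summit namespace repeats the problem name by design (D-0017)
set_option linter.dupNamespace false

namespace Summit.HubbardSuperconductivity.HubbardSuperconductivity.Cruxes.GoldstonePairProfile.Birth

open Matrix Finset Filter
open Literature.Probability.LatticeModels Literature.MathematicalPhysics.QuantumLattice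
open Summit.HubbardSuperconductivity.HubbardSuperconductivity.Theses.FunctionFieldCertificate
open Summit.HubbardSuperconductivity.HubbardSuperconductivity.Theorems.FunctionFieldCertificate
open scoped ComplexOrder

/-- DRAFT-LOCAL copy of piece (A) (verbatim the child statement; replaced by the route decl
`Theses.FunctionFieldCertificate.GoldstonePairProfile` once the split is filed). -/
def GoldstonePairProfile : Prop :=
  ∀ U : ℝ, 0 < U → ∀ δ ∈ Set.Ioo (0:ℝ) (1 / 2), ∃ S A : ℝ, 0 ≤ S ∧ 0 ≤ A ∧ ∃ L₀ : ℕ, ∀ (L : ℕ) [NeZero L], L₀ ≤ L → Even L → ∀ ψ : Literature.MathematicalPhysics.QuantumLattice.Fock (Literature.MathematicalPhysics.QuantumLattice.Orb (Literature.MathematicalPhysics.QuantumLattice.FermionTorus 2 L)), star ψ ⬝ᵥ ψ = 1 → Literature.MathematicalPhysics.QuantumLattice.IsGroundStateInSector (Literature.MathematicalPhysics.QuantumLattice.hubbardTorus 2 L 1 U) (2 * ⌊(1 - δ) * (L : ℝ) ^ 2 / 2⌋₊) 0 ψ → ∀ m : Literature.Probability.LatticeModels.TorusSite 2 L, m ≠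 0 → Literature.MathematicalPhysics.QuantumLattice.pairStructureFactor Literature.MathematicalPhysics.QuantumLattice.dWaveFormFactor L ψ m ≤ S + A / Real.sqrt (Literature.MathematicalPhysics.QuantumLattice.momentumNormSq L m)

/-! ### The two stubs -/

/-- **Stub (GS) `stub_pairGoldstoneShape`** — WINDOW GOLDSTONE SHAPE of the `d`-wave pair structure factor in
every sector ground state: for all `U > 0`, `δ ∈ (0,1/2)` there are `A ≥ 0`, `ε₀ > 0`, `L₀` such that every
normalised `(N_L,0)`-sector ground state `ψ` of `hubbardTorus 2 L 1 U`, `L ≥ L₀` even, has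
`S_ψ(m) · |q_m| ≤ A` for every `m ≠ 0` with `|q_m| ≤ ε₀`. Verbatim the hypothesis of `wib_of_goldstoneShape`
(so it closes stmt-1089 alone) and the output of the three landed stmt-1089 engines A/B/C, whose inputs
(torus pair stiffness; C⁺_λ pair Gaussian domination + charging floor `pairGap ≥ -κ/L`; exponent-one pair-yrast
floor) are the open physics. Why it might fail: ∀(U,δ)-exposed — one sector GS anywhere with a `|Q| → 0`
pair-density wave, superconducting-puddle phase separation or a twisted condensate at `|q| = 2π/L` has
`S_ψ(q)|q| ≳ L` on the window; no reflection-positivity-free `T = 0` infrared bound is known for any quantum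
lattice model (Cruxes/WindowInfraredBound/STRATEGY-CENSUS.md §6). OPEN. -/
theorem stub_pairGoldstoneShape :
    ∀ U : ℝ, 0 < U → ∀ δ ∈ Set.Ioo (0:ℝ) (1 / 2), ∃ A ε₀ : ℝ, 0 ≤ A ∧ 0 < ε₀ ∧ ∃ L₀ : ℕ,
      ∀ (L : ℕ) [NeZero L], L₀ ≤ L → Even L →
        ∀ ψ : Fock (Orb (FermionTorus 2 L)), star ψ ⬝ᵥ ψ = 1 →
          IsGroundStateInSector (hubbardTorus 2 L 1 U) (2 * ⌊(1 - δ) * (L : ℝ) ^ 2 / 2⌋₊) 0 ψ →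
            ∀ m : TorusSite 2 L, m ≠ 0 → momentumNormSq L m ≤ ε₀ ^ 2 →
              pairStructureFactor dWaveFormFactor L ψ m * Real.sqrt (momentumNormSq L m) ≤ A := by
  sorry

/-- **Stub (Flat) `stub_offWindowFlat`** — FLAT LAW OFF EVERY WINDOW: for all `U > 0`, `δ ∈ (0,1/2)` and
every `η > 0` there are `S ≥ 0`, `L₀` such that every normalised `(N_L,0)`-sector ground state `ψ` of
`hubbardTorus 2 L 1 U`, `L ≥ L₀` even, has `S_ψ(m) ≤ S` for every `m` with `|q_m| > η`: no pair-density-wave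
Bragg peak (`S_ψ(Q) ~ L²`) and no `L`-divergent pile-up at any FIXED nonzero momentum, in any sector ground
state. Why it might fail: ∀(U,δ)-exposed — PDW order at a fixed `Q ≠ 0` in some sector GS of the stripe
regime (`U ≳ 6`, `δ ≈ 1/8`: QinEtAl2020, XuEtAl2024 report PDW CORRELATIONS, decaying, in the pure model;
PDW long-range order in a Hubbard ground state is not established numerically or rigorously either way); a
priori only the Parseval total `Σ_m S_ψ(m) ≤ 32 L²` constrains a single mode. OPEN. -/
theorem stub_offWindowFlat :
    ∀ U : ℝ, 0 < U → ∀ δ ∈ Set.Ioo (0:ℝ) (1 / 2), ∀ η : ℝ, 0 < η → ∃ S : ℝ, 0 ≤ S ∧ ∃ L₀ : ℕ,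
      ∀ (L : ℕ) [NeZero L], L₀ ≤ L → Even L →
        ∀ ψ : Fock (Orb (FermionTorus 2 L)), star ψ ⬝ᵥ ψ = 1 →
          IsGroundStateInSector (hubbardTorus 2 L 1 U) (2 * ⌊(1 - δ) * (L : ℝ) ^ 2 / 2⌋₊) 0 ψ →
            ∀ m : TorusSite 2 L, η ^ 2 < momentumNormSq L m →
              pairStructureFactor dWaveFormFactor L ψ m ≤ S := by
  sorry

/-! ### Composition -/

/-- **The skeleton closes piece (A) modulo its two stubs**: `GoldstonePairProfile` from `stub_pairGoldstoneShape`
(GS) and `stub_offWindowFlat` (Flat) through the landed `goldstonePairProfileIffShapeAndFlat` (⇐: off the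
window `ε₀` the flat law gives `S := S(ε₀)`, on it the shape gives `A/|q|`). [folklore] -/
theorem GoldstonePairProfile_of : GoldstonePairProfile :=
  goldstonePairProfileIffShapeAndFlat.mpr ⟨stub_pairGoldstoneShape, stub_offWindowFlat⟩

end Summit.HubbardSuperconductivity.HubbardSuperconductivity.Cruxes.GoldstonePairProfile.Birth
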